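import Mathlib
import HarnessLib
import Summits.Ventures.LatticeQCDFlow.Scaling.TorusDiagonalLimit2D
import Summits.Ventures.LatticeQCDFlow.TrivializingMaps.HaarTraceMomentsSUn
import Summits.Ventures.LatticeQCDFlow.TrivializingMaps.WilsonSU2FisherZeroRadius
import Summits.Ventures.LatticeQCDFlow.TrivializingMaps.PlaquetteHaarMoments
import Summits.Ventures.LatticeQCDFlow.TrivializingMaps.U1WilsonFisherZero
import Summits.Ventures.LatticeQCDFlow.TrivializingMaps.UNHaarTraceMoments
import Literature.MathematicalPhysics.QuantumLattice.GaugeGroups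

/-!
# LatticeQCDFlow / Scaling — THE DIAGONAL ON THE 2-d U(1), SU(2), SU(N) AND U(N) TORI: the one-plaquette
# variance `σ² = Var_Haar(Re tr)` is `1/2` for U(1), `1` for SU(2), `1/2` for SU(N ≥ 3) and U(N); hence at
# `β_L√(L² − 1) = c` the untrained sampler on the periodic `L × L` torus has acceptance
# `→ erfc(|c|/(2√2))`, `erfc(|c|/2)`, `erfc(|c|/(2√2))`, ESS `→ e^{−c²σ²}`, reverse loss `→ c²σ²/2`

HONEST FRAMING: exact (Metropolis-corrected) sampling algorithms for lattice gauge theory;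
figures of merit are autocorrelation/cost numbers at stated couplings and volumes; no
continuum-physics claim.

Venture `LatticeQCDFlow` (cell pub-lqcd), topic `Scaling`; FANOUT row 3 (`s0-u1-a`, S0-B
implementation A: the 2-d U(1) flow sampler on the `16 × 16` torus, GEN-21).  NEW WORK of the cell,
no numerics, NO definition.  `Scaling/TorusDiagonalLimit2D` (imported) proves, for every compact gauge
group, that along `β_L = c/√(L² − 1)` the untrained exact sampler of 2-d Wilson lattice gauge theory
on the periodic torus has acceptance `→ ∫∫ min(eˣ, eʸ) dN(−s/2, s)²`, Kish ESS `→ e^{−s}`, reverse loss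
`→ s/2` with `s = c²·Var_Haar(Re tr ρ)`.  This file evaluates the constant for the groups of the
cell's ladder in their defining representations (`Literature…GaugeGroups.u1Rep`, `fundamentalRep`;
Wilson action `S = Σ_p (N − Re tr U_p)` of `Literature…ConstructiveQFTWave0`), reusing the tree's Haar
facts — the flow seat's `U(1)` moments (`TrivializingMaps/U1WilsonFisherZero`) and trace moments on `SU(n)` (`TrivializingMaps/PlaquetteHaarMoments.integral_trace_haar_eq_zero`,
`WilsonSU2FisherZeroRadius.haarSqReTrace_su2`, `HaarTraceMomentsSUn.haarSqReTrace_eq_half`):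

* §1 U(1) = `Circle`, `N = 1`: `re_trace_u1Rep`, `integral_re_haar_circle` (`= 0`),
  `integral_re_sq_haar_circle` (`= 1/2`), **`TrivializingMaps.variance_re_haar_circle`** (`σ² = 1/2`; the same number
  as row 3's `variance_cos_uniform` for the uniform angle law, here on the group); SU(n):
  `integral_re_trace_sun_eq_zero` (`n ≥ 2`), **`variance_re_trace_su2`** (`σ² = 1`),
  **`variance_re_trace_sun`** (`σ² = 1/2`, `n ≥ 3`);
* §2 **`u1Torus_meanAccept_diag_tendsto_erfc`** (`→ (2/√π)∫_{√(c²/2)/2}^∞ e^{−u²} du = erfc(|c|/(2√2))`),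
  **`u1Torus_essFrac_diag_tendsto`** (`→ e^{−c²/2}`), **`u1Torus_reverseKL_diag_tendsto`** (`→ c²/4`,
  GEN-20's `Scaling/PlaquetteLossDiagonalLaw` value for the factorised U(1) model, now on the torus);
* §3 **`su2Torus_…`** (`erfc(|c|/2)`, `e^{−c²}`, `c²/2`); §4 **`sunTorus_…`** (`n ≥ 3`:
  `erfc(|c|/(2√2))`, `e^{−c²/2}`, `c²/4`); §5 **`unTorus_…`** (U(N), `N ≥ 1`, `σ² = 1/2` =
  `TrivializingMaps/UNHaarTraceMoments.un_variance_re_trace`, reused: as SU(N ≥ 3)).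

Reading (value-free; no number of ours at the cell's `(β, L)` is computed or implied): in two dimensions
the zero-training baselines on the periodic torus have, in the window `β√V = c`, the universal profiles
with `σ² = 1/2` (U(1), SU(3)) and `σ² = 1` (SU(2)).  NOT CLAIMED: `β = c/L` (`Scaling/TorusCouplingSequences2D`); `d = 4` (R1a/R1
are four-dimensional, where plaquettes off a point are not independent); rates; any value at the
cell's `(β, L)`; nothing re-scored, SEALED.md untouched.
-/

noncomputable section

namespace Summit.Ventures.LatticeQCDFlow.Theory2

open MeasureTheory ProbabilityTheory Filter Finset Real Set
open Literature.MathematicalPhysics.QuantumFieldTheory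
open Literature.MathematicalPhysics.QuantumLattice
open scoped Topology

/-! ## §1 The one-plaquette constants: U(1) from the flow seat's `TrivializingMaps/U1WilsonFisherZero`
(`variance_re_haar_circle`, reused); SU(n) below -/


/-! ### The one-plaquette constants of SU(n) -/

section SUConstants

variable {n : ℕ}

/-- The real trace is continuous on `SU(n)`. [folklore] -/
theorem continuous_re_trace_sun :
    Continuous fun g : Matrix.specialUnitaryGroup (Fin n) ℂ => ((g : Matrix (Fin n) (Fin n) ℂ)).trace.re :=
  Complex.continuous_re.comp continuous_subtype_val.matrix_trace

/-- **`Var_Haar(Re tr) = 1` on SU(2)** (`∫ (Re tr)² = 1`, the flow seat's `haarSqReTrace_su2`; mean `0`).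
[ours] -/
theorem variance_re_trace_su2 :
    Var[fun g : Matrix.specialUnitaryGroup (Fin 2) ℂ => (fundamentalRep (Fin 2) g).trace.re;
      haarProbability (Matrix.specialUnitaryGroup (Fin 2) ℂ)] = 1 := by
  simp_rw [fundamentalRep_apply]
  rw [variance_eq_integral continuous_re_trace_sun.aemeasurable]
  simp only [TrivializingMaps.integral_re_trace_haar_eq_zero (le_refl 2), sub_zero]
  exact TrivializingMaps.haarSqReTrace_su2

/-- **`Var_Haar(Re tr) = 1/2` on SU(n), `n ≥ 3`** (the flow seat's `haarSqReTrace_eq_half`; mean `0`). [ours] -/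
theorem variance_re_trace_sun (hn : 3 ≤ n) :
    Var[fun g : Matrix.specialUnitaryGroup (Fin n) ℂ => (fundamentalRep (Fin n) g).trace.re;
      haarProbability (Matrix.specialUnitaryGroup (Fin n) ℂ)] = 1 / 2 := by
  simp_rw [fundamentalRep_apply]
  rw [variance_eq_integral continuous_re_trace_sun.aemeasurable]
  simp only [TrivializingMaps.integral_re_trace_haar_eq_zero (by omega : 2 ≤ n), sub_zero]
  exact TrivializingMaps.haarSqReTrace_eq_half hn

end SUConstants

/-! ## §2 The diagonal on the U(1) torus -/

section U1Torus

/-- **THE DIAGONAL ACCEPTANCE PROFILE OF THE UNTRAINED 2-d U(1) SAMPLER ON THE TORUS IS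
`erfc(|c|/(2√2))`**: at `β_L = c/√(L² − 1)`, `c ≠ 0`, the equilibrium acceptance on the periodic
`L × L` torus (`L = k + 2 → ∞`) tends to `(2/√π)∫_{√(c²/2)/2}^∞ e^{−u²} du`. [ours] -/
theorem u1Torus_meanAccept_diag_tendsto_erfc {c : ℝ} (hc : c ≠ 0) :
    Tendsto (fun k : ℕ =>
        ∫ U, ∫ U', min
            (Real.exp (-(c / Real.sqrt ((((k + 2) ^ 2 - 1 : ℕ)) : ℝ)) * wilsonAction u1Rep U) /
              ∫ V, Real.exp (-(c / Real.sqrt ((((k + 2) ^ 2 - 1 : ℕ)) : ℝ)) * wilsonAction u1Rep V)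
                ∂(Measure.pi fun _ : Edge 2 (k + 2) => haarProbability Circle))
            (Real.exp (-(c / Real.sqrt ((((k + 2) ^ 2 - 1 : ℕ)) : ℝ)) * wilsonAction u1Rep U') /
              ∫ V, Real.exp (-(c / Real.sqrt ((((k + 2) ^ 2 - 1 : ℕ)) : ℝ)) * wilsonAction u1Rep V)
                ∂(Measure.pi fun _ : Edge 2 (k + 2) => haarProbability Circle))
          ∂(Measure.pi fun _ : Edge 2 (k + 2) => haarProbability Circle)
          ∂(Measure.pi fun _ : Edge 2 (k + 2) => haarProbability Circle))
      atTop (𝓝 (2 / Real.sqrt Real.pi * ∫ u in Ioi (Real.sqrt (c ^ 2 / 2) / 2), Real.exp (-u ^ 2))) := by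
  have h := torus_meanAccept_diag_tendsto_erfc u1Rep continuous_u1Rep hc
    (by rw [TrivializingMaps.variance_re_haar_circle]; norm_num)
  rw [TrivializingMaps.variance_re_haar_circle] at h
  convert h using 5
  ring

/-- **The diagonal ESS of the untrained 2-d U(1) sampler on the torus tends to `e^{−c²/2}`.** [ours] -/
theorem u1Torus_essFrac_diag_tendsto (c : ℝ) :
    Tendsto (fun k : ℕ =>
        (∫ U, Real.exp (-(c / Real.sqrt ((((k + 2) ^ 2 - 1 : ℕ)) : ℝ)) * wilsonAction u1Rep U) /
              ∫ V, Real.exp (-(c / Real.sqrt ((((k + 2) ^ 2 - 1 : ℕ)) : ℝ)) * wilsonAction u1Rep V)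
                ∂(Measure.pi fun _ : Edge 2 (k + 2) => haarProbability Circle)
            ∂(Measure.pi fun _ : Edge 2 (k + 2) => haarProbability Circle)) ^ 2 /
          ∫ U, (Real.exp (-(c / Real.sqrt ((((k + 2) ^ 2 - 1 : ℕ)) : ℝ)) * wilsonAction u1Rep U) /
              ∫ V, Real.exp (-(c / Real.sqrt ((((k + 2) ^ 2 - 1 : ℕ)) : ℝ)) * wilsonAction u1Rep V)
                ∂(Measure.pi fun _ : Edge 2 (k + 2) => haarProbability Circle)) ^ 2
            ∂(Measure.pi fun _ : Edge 2 (k + 2) => haarProbability Circle))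
      atTop (𝓝 (Real.exp (-(c ^ 2 / 2)))) := by
  have h := torus_essFrac_diag_tendsto u1Rep continuous_u1Rep c
  rw [TrivializingMaps.variance_re_haar_circle] at h
  convert h using 3
  ring

/-- **The diagonal reverse loss of the untrained 2-d U(1) sampler on the torus tends to `c²/4`** (the
factorised U(1) value of GEN-20's `Scaling/PlaquetteLossDiagonalLaw`, now on the torus). [ours] -/
theorem u1Torus_reverseKL_diag_tendsto (c : ℝ) :
    Tendsto (fun k : ℕ =>
        ∫ U, Real.log (1 / (Real.exp (-(c / Real.sqrt ((((k + 2) ^ 2 - 1 : ℕ)) : ℝ)) *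
              wilsonAction u1Rep U) /
            ∫ V, Real.exp (-(c / Real.sqrt ((((k + 2) ^ 2 - 1 : ℕ)) : ℝ)) * wilsonAction u1Rep V)
              ∂(Measure.pi fun _ : Edge 2 (k + 2) => haarProbability Circle)))
          ∂(Measure.pi fun _ : Edge 2 (k + 2) => haarProbability Circle))
      atTop (𝓝 (c ^ 2 / 4)) := by
  have h := torus_reverseKL_diag_tendsto u1Rep continuous_u1Rep c
  rw [TrivializingMaps.variance_re_haar_circle] at h
  convert h using 2
  ring

end U1Torus
/-! ## §3 The diagonal on the SU(2) torus (`σ² = 1`) -/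

section SU2

/-- **The diagonal acceptance profile of the untrained 2-d SU2 sampler on the torus**: at
`β_L = c/√(L² − 1)`, `c ≠ 0`, the equilibrium acceptance on the periodic `L × L` torus (`L = k + 2 → ∞`)
tends to `(2/√π)∫_{|c|/2}^∞ e^{−u²} du = erfc(|c|/2)` (`σ² = 1`). [ours] -/
theorem su2Torus_meanAccept_diag_tendsto_erfc {c : ℝ} (hc : c ≠ 0) :
    Tendsto (fun k : ℕ =>
        ∫ U, ∫ U', min
            (Real.exp (-(c / Real.sqrt ((((k + 2) ^ 2 - 1 : ℕ)) : ℝ)) * wilsonAction (fundamentalRep (Fin 2)) U) /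
              ∫ V, Real.exp (-(c / Real.sqrt ((((k + 2) ^ 2 - 1 : ℕ)) : ℝ)) * wilsonAction (fundamentalRep (Fin 2)) V)
                ∂(Measure.pi fun _ : Edge 2 (k + 2) => haarProbability (Matrix.specialUnitaryGroup (Fin 2) ℂ)))
            (Real.exp (-(c / Real.sqrt ((((k + 2) ^ 2 - 1 : ℕ)) : ℝ)) * wilsonAction (fundamentalRep (Fin 2)) U') /
              ∫ V, Real.exp (-(c / Real.sqrt ((((k + 2) ^ 2 - 1 : ℕ)) : ℝ)) * wilsonAction (fundamentalRep (Fin 2)) V)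
                ∂(Measure.pi fun _ : Edge 2 (k + 2) => haarProbability (Matrix.specialUnitaryGroup (Fin 2) ℂ)))
          ∂(Measure.pi fun _ : Edge 2 (k + 2) => haarProbability (Matrix.specialUnitaryGroup (Fin 2) ℂ))
          ∂(Measure.pi fun _ : Edge 2 (k + 2) => haarProbability (Matrix.specialUnitaryGroup (Fin 2) ℂ)))
      atTop (𝓝 (2 / Real.sqrt Real.pi * ∫ u in Ioi (|c| / 2), Real.exp (-u ^ 2))) := by
  haveI : SecondCountableTopology (Matrix (Fin 2) (Fin 2) ℂ) :=
    inferInstanceAs (SecondCountableTopology (Fin 2 → Fin 2 → ℂ))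
  haveI : SecondCountableTopology (Matrix.specialUnitaryGroup (Fin 2) ℂ) :=
    Topology.IsEmbedding.subtypeVal.secondCountableTopology
  have h := torus_meanAccept_diag_tendsto_erfc (fundamentalRep (Fin 2)) (continuous_fundamentalRep (Fin 2)) hc
    (by rw [variance_re_trace_su2]; norm_num)
  rw [variance_re_trace_su2, mul_one, Real.sqrt_sq_eq_abs] at h
  exact h

/-- **The diagonal ESS of the untrained 2-d SU2 sampler on the torus tends to `c ^ 2`.** [ours] -/
theorem su2Torus_essFrac_diag_tendsto (c : ℝ) :
    Tendsto (fun k : ℕ =>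
        (∫ U, Real.exp (-(c / Real.sqrt ((((k + 2) ^ 2 - 1 : ℕ)) : ℝ)) * wilsonAction (fundamentalRep (Fin 2)) U) /
              ∫ V, Real.exp (-(c / Real.sqrt ((((k + 2) ^ 2 - 1 : ℕ)) : ℝ)) * wilsonAction (fundamentalRep (Fin 2)) V)
                ∂(Measure.pi fun _ : Edge 2 (k + 2) => haarProbability (Matrix.specialUnitaryGroup (Fin 2) ℂ))
            ∂(Measure.pi fun _ : Edge 2 (k + 2) => haarProbability (Matrix.specialUnitaryGroup (Fin 2) ℂ))) ^ 2 /
          ∫ U, (Real.exp (-(c / Real.sqrt ((((k + 2) ^ 2 - 1 : ℕ)) : ℝ)) * wilsonAction (fundamentalRep (Fin 2)) U) /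
              ∫ V, Real.exp (-(c / Real.sqrt ((((k + 2) ^ 2 - 1 : ℕ)) : ℝ)) * wilsonAction (fundamentalRep (Fin 2)) V)
                ∂(Measure.pi fun _ : Edge 2 (k + 2) => haarProbability (Matrix.specialUnitaryGroup (Fin 2) ℂ))) ^ 2
            ∂(Measure.pi fun _ : Edge 2 (k + 2) => haarProbability (Matrix.specialUnitaryGroup (Fin 2) ℂ)))
      atTop (𝓝 (Real.exp (-(c ^ 2)))) := by
  haveI : SecondCountableTopology (Matrix (Fin 2) (Fin 2) ℂ) :=
    inferInstanceAs (SecondCountableTopology (Fin 2 → Fin 2 → ℂ))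
  haveI : SecondCountableTopology (Matrix.specialUnitaryGroup (Fin 2) ℂ) :=
    Topology.IsEmbedding.subtypeVal.secondCountableTopology
  have h := torus_essFrac_diag_tendsto (fundamentalRep (Fin 2)) (continuous_fundamentalRep (Fin 2)) c
  rw [variance_re_trace_su2] at h
  convert h using 3
  ring

/-- **The diagonal reverse loss of the untrained 2-d SU2 sampler on the torus tends to `c ^ 2 / 2`.** [ours] -/
theorem su2Torus_reverseKL_diag_tendsto (c : ℝ) :
    Tendsto (fun k : ℕ =>
        ∫ U, Real.log (1 / (Real.exp (-(c / Real.sqrt ((((k + 2) ^ 2 - 1 : ℕ)) : ℝ)) *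
              wilsonAction (fundamentalRep (Fin 2)) U) /
            ∫ V, Real.exp (-(c / Real.sqrt ((((k + 2) ^ 2 - 1 : ℕ)) : ℝ)) * wilsonAction (fundamentalRep (Fin 2)) V)
              ∂(Measure.pi fun _ : Edge 2 (k + 2) => haarProbability (Matrix.specialUnitaryGroup (Fin 2) ℂ))))
          ∂(Measure.pi fun _ : Edge 2 (k + 2) => haarProbability (Matrix.specialUnitaryGroup (Fin 2) ℂ)))
      atTop (𝓝 (c ^ 2 / 2)) := by
  haveI : SecondCountableTopology (Matrix (Fin 2) (Fin 2) ℂ) :=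
    inferInstanceAs (SecondCountableTopology (Fin 2 → Fin 2 → ℂ))
  haveI : SecondCountableTopology (Matrix.specialUnitaryGroup (Fin 2) ℂ) :=
    Topology.IsEmbedding.subtypeVal.secondCountableTopology
  have h := torus_reverseKL_diag_tendsto (fundamentalRep (Fin 2)) (continuous_fundamentalRep (Fin 2)) c
  rw [variance_re_trace_su2] at h
  convert h using 2
  ring

end SU2

/-! ## §4 The diagonal on the SU(N) torus, `N ≥ 3` (`σ² = 1/2`) -/

section SUN

variable {n : ℕ}

/-- **The diagonal acceptance profile of the untrained 2-d SUN sampler on the torus**: at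
`β_L = c/√(L² − 1)`, `c ≠ 0`, the equilibrium acceptance on the periodic `L × L` torus (`L = k + 2 → ∞`)
tends to `(2/√π)∫_{√(c²/2)/2}^∞ e^{−u²} du = erfc(|c|/(2√2))` (`σ² = 1/2`). [ours] -/
theorem sunTorus_meanAccept_diag_tendsto_erfc (hn : 3 ≤ n) {c : ℝ} (hc : c ≠ 0) :
    Tendsto (fun k : ℕ =>
        ∫ U, ∫ U', min
            (Real.exp (-(c / Real.sqrt ((((k + 2) ^ 2 - 1 : ℕ)) : ℝ)) * wilsonAction (fundamentalRep (Fin n)) U) /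
              ∫ V, Real.exp (-(c / Real.sqrt ((((k + 2) ^ 2 - 1 : ℕ)) : ℝ)) * wilsonAction (fundamentalRep (Fin n)) V)
                ∂(Measure.pi fun _ : Edge 2 (k + 2) => haarProbability (Matrix.specialUnitaryGroup (Fin n) ℂ)))
            (Real.exp (-(c / Real.sqrt ((((k + 2) ^ 2 - 1 : ℕ)) : ℝ)) * wilsonAction (fundamentalRep (Fin n)) U') /
              ∫ V, Real.exp (-(c / Real.sqrt ((((k + 2) ^ 2 - 1 : ℕ)) : ℝ)) * wilsonAction (fundamentalRep (Fin n)) V)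
                ∂(Measure.pi fun _ : Edge 2 (k + 2) => haarProbability (Matrix.specialUnitaryGroup (Fin n) ℂ)))
          ∂(Measure.pi fun _ : Edge 2 (k + 2) => haarProbability (Matrix.specialUnitaryGroup (Fin n) ℂ))
          ∂(Measure.pi fun _ : Edge 2 (k + 2) => haarProbability (Matrix.specialUnitaryGroup (Fin n) ℂ)))
      atTop (𝓝 (2 / Real.sqrt Real.pi * ∫ u in Ioi (Real.sqrt (c ^ 2 / 2) / 2), Real.exp (-u ^ 2))) := by
  haveI : SecondCountableTopology (Matrix (Fin n) (Fin n) ℂ) :=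
    inferInstanceAs (SecondCountableTopology (Fin n → Fin n → ℂ))
  haveI : SecondCountableTopology (Matrix.specialUnitaryGroup (Fin n) ℂ) :=
    Topology.IsEmbedding.subtypeVal.secondCountableTopology
  have h := torus_meanAccept_diag_tendsto_erfc (fundamentalRep (Fin n)) (continuous_fundamentalRep (Fin n)) hc
    (by rw [variance_re_trace_sun hn]; norm_num)
  rw [variance_re_trace_sun hn] at h
  convert h using 5
  ring

/-- **The diagonal ESS of the untrained 2-d SUN sampler on the torus tends to `c ^ 2 / 2`.** [ours] -/
theorem sunTorus_essFrac_diag_tendsto (hn : 3 ≤ n) (c : ℝ) :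
    Tendsto (fun k : ℕ =>
        (∫ U, Real.exp (-(c / Real.sqrt ((((k + 2) ^ 2 - 1 : ℕ)) : ℝ)) * wilsonAction (fundamentalRep (Fin n)) U) /
              ∫ V, Real.exp (-(c / Real.sqrt ((((k + 2) ^ 2 - 1 : ℕ)) : ℝ)) * wilsonAction (fundamentalRep (Fin n)) V)
                ∂(Measure.pi fun _ : Edge 2 (k + 2) => haarProbability (Matrix.specialUnitaryGroup (Fin n) ℂ))
            ∂(Measure.pi fun _ : Edge 2 (k + 2) => haarProbability (Matrix.specialUnitaryGroup (Fin n) ℂ))) ^ 2 /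
          ∫ U, (Real.exp (-(c / Real.sqrt ((((k + 2) ^ 2 - 1 : ℕ)) : ℝ)) * wilsonAction (fundamentalRep (Fin n)) U) /
              ∫ V, Real.exp (-(c / Real.sqrt ((((k + 2) ^ 2 - 1 : ℕ)) : ℝ)) * wilsonAction (fundamentalRep (Fin n)) V)
                ∂(Measure.pi fun _ : Edge 2 (k + 2) => haarProbability (Matrix.specialUnitaryGroup (Fin n) ℂ))) ^ 2
            ∂(Measure.pi fun _ : Edge 2 (k + 2) => haarProbability (Matrix.specialUnitaryGroup (Fin n) ℂ)))
      atTop (𝓝 (Real.exp (-(c ^ 2 / 2)))) := by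
  haveI : SecondCountableTopology (Matrix (Fin n) (Fin n) ℂ) :=
    inferInstanceAs (SecondCountableTopology (Fin n → Fin n → ℂ))
  haveI : SecondCountableTopology (Matrix.specialUnitaryGroup (Fin n) ℂ) :=
    Topology.IsEmbedding.subtypeVal.secondCountableTopology
  have h := torus_essFrac_diag_tendsto (fundamentalRep (Fin n)) (continuous_fundamentalRep (Fin n)) c
  rw [variance_re_trace_sun hn] at h
  convert h using 3
  ring

/-- **The diagonal reverse loss of the untrained 2-d SUN sampler on the torus tends to `c ^ 2 / 4`.** [ours] -/
theorem sunTorus_reverseKL_diag_tendsto (hn : 3 ≤ n) (c : ℝ) :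
    Tendsto (fun k : ℕ =>
        ∫ U, Real.log (1 / (Real.exp (-(c / Real.sqrt ((((k + 2) ^ 2 - 1 : ℕ)) : ℝ)) *
              wilsonAction (fundamentalRep (Fin n)) U) /
            ∫ V, Real.exp (-(c / Real.sqrt ((((k + 2) ^ 2 - 1 : ℕ)) : ℝ)) * wilsonAction (fundamentalRep (Fin n)) V)
              ∂(Measure.pi fun _ : Edge 2 (k + 2) => haarProbability (Matrix.specialUnitaryGroup (Fin n) ℂ))))
          ∂(Measure.pi fun _ : Edge 2 (k + 2) => haarProbability (Matrix.specialUnitaryGroup (Fin n) ℂ)))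
      atTop (𝓝 (c ^ 2 / 4)) := by
  haveI : SecondCountableTopology (Matrix (Fin n) (Fin n) ℂ) :=
    inferInstanceAs (SecondCountableTopology (Fin n → Fin n → ℂ))
  haveI : SecondCountableTopology (Matrix.specialUnitaryGroup (Fin n) ℂ) :=
    Topology.IsEmbedding.subtypeVal.secondCountableTopology
  have h := torus_reverseKL_diag_tendsto (fundamentalRep (Fin n)) (continuous_fundamentalRep (Fin n)) c
  rw [variance_re_trace_sun hn] at h
  convert h using 2
  ring

end SUN

/-! ## §5 The diagonal on the U(N) torus (`σ² = 1/2`, the flow seat's `un_variance_re_trace`) -/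

section UNTorus

variable {n : ℕ}

/-- **The diagonal acceptance profile of the untrained 2-d U(N) sampler on the torus** (`n ≥ 1`): at
`β_L = c/√(L² − 1)`, `c ≠ 0`, the equilibrium acceptance on the periodic `L × L` torus (`L = k + 2 → ∞`) tends
to `(2/√π)∫_{√(c²/2)/2}^∞ e^{−u²} du = erfc(|c|/(2√2))`. [ours] -/
theorem unTorus_meanAccept_diag_tendsto_erfc (hn : 1 ≤ n) {c : ℝ} (hc : c ≠ 0) :
    Tendsto (fun k : ℕ =>
        ∫ U, ∫ U', min
            (Real.exp (-(c / Real.sqrt ((((k + 2) ^ 2 - 1 : ℕ)) : ℝ)) * wilsonAction (unitaryFundamentalRep (Fin n) ℂ) U) /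
              ∫ V, Real.exp (-(c / Real.sqrt ((((k + 2) ^ 2 - 1 : ℕ)) : ℝ)) * wilsonAction (unitaryFundamentalRep (Fin n) ℂ) V)
                ∂(Measure.pi fun _ : Edge 2 (k + 2) => haarProbability (Matrix.unitaryGroup (Fin n) ℂ)))
            (Real.exp (-(c / Real.sqrt ((((k + 2) ^ 2 - 1 : ℕ)) : ℝ)) * wilsonAction (unitaryFundamentalRep (Fin n) ℂ) U') /
              ∫ V, Real.exp (-(c / Real.sqrt ((((k + 2) ^ 2 - 1 : ℕ)) : ℝ)) * wilsonAction (unitaryFundamentalRep (Fin n) ℂ) V)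
                ∂(Measure.pi fun _ : Edge 2 (k + 2) => haarProbability (Matrix.unitaryGroup (Fin n) ℂ)))
          ∂(Measure.pi fun _ : Edge 2 (k + 2) => haarProbability (Matrix.unitaryGroup (Fin n) ℂ))
          ∂(Measure.pi fun _ : Edge 2 (k + 2) => haarProbability (Matrix.unitaryGroup (Fin n) ℂ)))
      atTop (𝓝 (2 / Real.sqrt Real.pi * ∫ u in Ioi (Real.sqrt (c ^ 2 / 2) / 2), Real.exp (-u ^ 2))) := by
  haveI : SecondCountableTopology (Matrix (Fin n) (Fin n) ℂ) :=
    inferInstanceAs (SecondCountableTopology (Fin n → Fin n → ℂ))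
  haveI : SecondCountableTopology (Matrix.unitaryGroup (Fin n) ℂ) :=
    Topology.IsEmbedding.subtypeVal.secondCountableTopology
  have h := torus_meanAccept_diag_tendsto_erfc (unitaryFundamentalRep (Fin n) ℂ) (continuous_unitaryFundamentalRep (Fin n) ℂ) hc
    (by rw [TrivializingMaps.un_variance_re_trace hn]; norm_num)
  rw [TrivializingMaps.un_variance_re_trace hn] at h
  convert h using 5
  ring

/-- **The diagonal ESS of the untrained 2-d U(N) sampler on the torus tends to `c ^ 2 / 2`.** [ours] -/
theorem unTorus_essFrac_diag_tendsto (hn : 1 ≤ n) (c : ℝ) :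
    Tendsto (fun k : ℕ =>
        (∫ U, Real.exp (-(c / Real.sqrt ((((k + 2) ^ 2 - 1 : ℕ)) : ℝ)) * wilsonAction (unitaryFundamentalRep (Fin n) ℂ) U) /
              ∫ V, Real.exp (-(c / Real.sqrt ((((k + 2) ^ 2 - 1 : ℕ)) : ℝ)) * wilsonAction (unitaryFundamentalRep (Fin n) ℂ) V)
                ∂(Measure.pi fun _ : Edge 2 (k + 2) => haarProbability (Matrix.unitaryGroup (Fin n) ℂ))
            ∂(Measure.pi fun _ : Edge 2 (k + 2) => haarProbability (Matrix.unitaryGroup (Fin n) ℂ))) ^ 2 /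
          ∫ U, (Real.exp (-(c / Real.sqrt ((((k + 2) ^ 2 - 1 : ℕ)) : ℝ)) * wilsonAction (unitaryFundamentalRep (Fin n) ℂ) U) /
              ∫ V, Real.exp (-(c / Real.sqrt ((((k + 2) ^ 2 - 1 : ℕ)) : ℝ)) * wilsonAction (unitaryFundamentalRep (Fin n) ℂ) V)
                ∂(Measure.pi fun _ : Edge 2 (k + 2) => haarProbability (Matrix.unitaryGroup (Fin n) ℂ))) ^ 2
            ∂(Measure.pi fun _ : Edge 2 (k + 2) => haarProbability (Matrix.unitaryGroup (Fin n) ℂ)))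
      atTop (𝓝 (Real.exp (-(c ^ 2 / 2)))) := by
  haveI : SecondCountableTopology (Matrix (Fin n) (Fin n) ℂ) :=
    inferInstanceAs (SecondCountableTopology (Fin n → Fin n → ℂ))
  haveI : SecondCountableTopology (Matrix.unitaryGroup (Fin n) ℂ) :=
    Topology.IsEmbedding.subtypeVal.secondCountableTopology
  have h := torus_essFrac_diag_tendsto (unitaryFundamentalRep (Fin n) ℂ) (continuous_unitaryFundamentalRep (Fin n) ℂ) c
  rw [TrivializingMaps.un_variance_re_trace hn] at h
  convert h using 3
  ring

/-- **The diagonal reverse loss of the untrained 2-d U(N) sampler on the torus tends to `c ^ 2 / 4`.** [ours] -/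
theorem unTorus_reverseKL_diag_tendsto (hn : 1 ≤ n) (c : ℝ) :
    Tendsto (fun k : ℕ =>
        ∫ U, Real.log (1 / (Real.exp (-(c / Real.sqrt ((((k + 2) ^ 2 - 1 : ℕ)) : ℝ)) *
              wilsonAction (unitaryFundamentalRep (Fin n) ℂ) U) /
            ∫ V, Real.exp (-(c / Real.sqrt ((((k + 2) ^ 2 - 1 : ℕ)) : ℝ)) * wilsonAction (unitaryFundamentalRep (Fin n) ℂ) V)
              ∂(Measure.pi fun _ : Edge 2 (k + 2) => haarProbability (Matrix.unitaryGroup (Fin n) ℂ))))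
          ∂(Measure.pi fun _ : Edge 2 (k + 2) => haarProbability (Matrix.unitaryGroup (Fin n) ℂ)))
      atTop (𝓝 (c ^ 2 / 4)) := by
  haveI : SecondCountableTopology (Matrix (Fin n) (Fin n) ℂ) :=
    inferInstanceAs (SecondCountableTopology (Fin n → Fin n → ℂ))
  haveI : SecondCountableTopology (Matrix.unitaryGroup (Fin n) ℂ) :=
    Topology.IsEmbedding.subtypeVal.secondCountableTopology
  have h := torus_reverseKL_diag_tendsto (unitaryFundamentalRep (Fin n) ℂ) (continuous_unitaryFundamentalRep (Fin n) ℂ) c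
  rw [TrivializingMaps.un_variance_re_trace hn] at h
  convert h using 2
  ring

end UNTorus

end Summit.Ventures.LatticeQCDFlow.Theory2

end
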